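import Literature.NumberTheory.DiophantineGeometry.GenEllDeBadPrimes
import Literature.NumberTheory.DiophantineGeometry.GenEllDeFamilyGoodPrimesOrd
import HarnessLib

/-!
# [GenEll] Thm. 2.1 on the `D_e` route, family `t_c`: the finite set of bad primes `S_bad(e, c, B)`

S. Mochizuki, *Arithmetic elliptic curves in general position*, Math. J. Okayama Univ. 52 (2010),
Prop. 1.6 p. 10 / proof of Thm. 2.1 pp. 12–13 [cite: MochizukiGenEll2010, Prop 1.6 p.10]; support file
for the route item `GenEllTwo` (stmt-ABC-19679), W5 coordinator abc-iut-w5-d045 (R-a′ INTERFACE CONTRACT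
(1), family version required by abc-iut-S6's OWNER RULING #6 / amendment: the per-configuration
protection varies the function `t_c = 1/r + c·r^{k+1}/s`, `c ∈ ℚ^×`).

This is the `t_c`-twin of `GenEllDeBadPrimes.lean` (abc-iut-w5-d054, the case `c = 1`), reusing its
helpers by name:

* `DeC.map_fiber` — the fibre polynomial `G^c_b` over `K` maps to `G^{ιc}_{ιb}` over `L ⊇ K`;
* `DeC.exists_badPrimes` — for `k`, `c ≠ 0` and a finite `B ⊂ K` a finite set `S ∋ 2` of rational primes
  (depending on `k`, `c`, `B` only) such that at every finite place `w` of every number field `L ⊇ K`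
  not over `S`: `w(2) = 1`, `w(c) = 1`, every `b ∈ B` is `w`-integral, distinct `b, b′ ∈ B` have
  `w(b − b′) = 1`, and every fibre polynomial `G^c_b` satisfies the multiplicity-gap conclusion at `w`
  (abc-iut-w5-d027's uniform modulus) — the good-place hypotheses of `DeC.ord_placewise_of_gap`;
* `DeC.hmeet_hoff_off_badPrimes_of_subset` — the JUNCTION for every finite `T ⊇ S`: with
  `Sbad := ⋃_{p∈T} placesOver L p`, the hypotheses `hmeet`/`hoff` of
  `FibreConductor.inv_finrank_mul_sum_logNorm_le_slope` (abc-iut-w5-d009) hold off `Sbad` given only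
  the curve/`t_c`/`N_c` normal forms, `t ∉ B`, the W5c converse `hconv` off `Sbad` and a finite set `W`
  of places meeting `B` off `Sbad`.

Theorems only; classical; nothing here bears on [IUTchIII] Cor. 3.12.
-/

noncomputable section

namespace Literature.NumberTheory.DiophantineGeometry.GenEll

open _root_.Polynomial NumberField IsDedekindDomain
open Literature.IUT.LogVolume

universe u

/-- The fibre polynomial `G^c_b` over `K` maps to `G^{ιc}_{ιb}` over `L` under `ι = algebraMap K L`.
[cite: MochizukiGenEll2010, Prop 1.6 p.10] -/
theorem DeC.map_fiber (k : ℕ) {K L : Type*} [Field K] [Field L] [Algebra K L] (c b : K) {g : K[X]}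
    (hg : g = C (c ^ 2) * X ^ (2 * k + 4) + C (4 * b ^ 2) * X ^ (2 * k + 3) - C (8 * b) * X ^ (2 * k + 2)
      + C 4 * X ^ (2 * k + 1) - C (b ^ 2) * X ^ 2 + C (2 * b) * X - 1)
    {g' : L[X]}
    (hg' : g' = C ((algebraMap K L c) ^ 2) * X ^ (2 * k + 4)
      + C (4 * (algebraMap K L b) ^ 2) * X ^ (2 * k + 3) - C (8 * algebraMap K L b) * X ^ (2 * k + 2)
      + C 4 * X ^ (2 * k + 1) - C ((algebraMap K L b) ^ 2) * X ^ 2 + C (2 * algebraMap K L b) * X - 1) :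
    g.map (algebraMap K L) = g' := by
  subst hg hg'
  simp [Polynomial.map_sub, Polynomial.map_add, Polynomial.map_mul, Polynomial.map_pow, map_ofNat]

section BadPrimes

variable {K : Type u} [Field K] [NumberField K]

open scoped Classical in
/-- **The bad primes `S_bad(e, c, B)` for the family `t_c`.** For `k` (`e = 2k+1`), `c ≠ 0` and a finite
set `B` in a number field `K` there is a finite set `S ∋ 2` of rational primes — depending only on
`k`, `c`, `B` — such that for every number field `L ⊇ K` and every finite place `w` of `L` not over `S`:
`w(2) = 1`, `w(c) = 1`, every `b ∈ B` is `w`-integral, distinct `b, b′ ∈ B` have `w(b − b′) = 1`, and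
every fibre polynomial `G^c_b` (`b ∈ B`) satisfies the multiplicity-gap conclusion at `w`.
[cite: MochizukiGenEll2010, Prop 1.6 p.10] -/
theorem DeC.exists_badPrimes (k : ℕ) {c : K} (hc : c ≠ 0) (B : Finset K) :
    ∃ S : Finset ℕ, 2 ∈ S ∧ (∀ p ∈ S, p.Prime) ∧
      ∀ (L : Type u) [Field L] [NumberField L] [Algebra K L] (w : HeightOneSpectrum (𝓞 L)),
        w ∉ S.attach.biUnion (fun p => placesOver L p.1) →
        w.valuation L (2 : L) = 1 ∧ w.valuation L (algebraMap K L c) = 1 ∧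
        (∀ b ∈ B, w.valuation L (algebraMap K L b) ≤ 1) ∧
        (∀ b ∈ B, ∀ b' ∈ B, b ≠ b' →
          w.valuation L (algebraMap K L b - algebraMap K L b') = 1) ∧
        (∀ b ∈ B, ∀ g : L[X],
          g = C ((algebraMap K L c) ^ 2) * X ^ (2 * k + 4)
            + C (4 * (algebraMap K L b) ^ 2) * X ^ (2 * k + 3)
            - C (8 * algebraMap K L b) * X ^ (2 * k + 2) + C 4 * X ^ (2 * k + 1)
            - C ((algebraMap K L b) ^ 2) * X ^ 2 + C (2 * algebraMap K L b) * X - 1 →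
          ∀ ρ : L, w.valuation L ρ ≤ 1 → g.eval ρ ≠ 0 → w.valuation L (g.eval ρ) < 1 →
            w.valuation L (g.eval ρ) < w.valuation L ((derivative g).eval ρ)) := by
  classical
  -- (1) integrality of `B`
  obtain ⟨D₁, hD₁0, hD₁⟩ := exists_modulus_valuation_le_one (K := K) B
  -- (2) separation of `B`
  obtain ⟨D₂, hD₂0, hD₂⟩ := exists_modulus_valuation_eq_one (K := K)
    (((B ×ˢ B).image fun q => q.1 - q.2).filter fun x => x ≠ 0) (fun x hx => (Finset.mem_filter.mp hx).2)
  -- (3) `c` is a unit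
  obtain ⟨D₄, hD₄0, hD₄⟩ := exists_modulus_valuation_eq_one (K := K) ({c} : Finset K)
    (fun x hx => by rw [Finset.mem_singleton] at hx; rw [hx]; exact hc)
  -- (4) good reduction of the fibre polynomials
  let G : K → K[X] := fun b => C (c ^ 2) * X ^ (2 * k + 4) + C (4 * b ^ 2) * X ^ (2 * k + 3)
    - C (8 * b) * X ^ (2 * k + 2) + C 4 * X ^ (2 * k + 1) - C (b ^ 2) * X ^ 2 + C (2 * b) * X - 1
  have hG0 : ∀ b ∈ B, G b ≠ 0 := fun b _ => DeC.fiber_ne_zero k b (g := G b) rfl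
  obtain ⟨D₃, hD₃0, hD₃⟩ :=
    GoodPrime.exists_modulus_val_aeval_lt_val_aeval_derivative_finset B G hG0
  -- the modulus and its prime factors
  set D : ℕ := 2 * D₁ * D₂ * D₃ * D₄ with hDdef
  have hD0 : D ≠ 0 := by positivity
  refine ⟨D.primeFactors, Nat.mem_primeFactors.mpr ⟨Nat.prime_two, ⟨D₁ * D₂ * D₃ * D₄, by ring⟩, hD0⟩,
    fun p hp => Nat.prime_of_mem_primeFactors hp, fun L _ _ _ w hw => ?_⟩
  have hwD : w.valuation L (D : L) = 1 := valuation_natCast_eq_one_of_not_mem_biUnion w hD0 hw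
  have hw2 : w.valuation L (2 : L) = 1 := by
    have h := valuation_natCast_eq_one_of_dvd w (⟨D₁ * D₂ * D₃ * D₄, by ring⟩ : 2 ∣ D) hwD
    simpa using h
  have hw1 : w.valuation L (D₁ : L) = 1 :=
    valuation_natCast_eq_one_of_dvd w (⟨2 * D₂ * D₃ * D₄, by ring⟩ : D₁ ∣ D) hwD
  have hw2' : w.valuation L (D₂ : L) = 1 :=
    valuation_natCast_eq_one_of_dvd w (⟨2 * D₁ * D₃ * D₄, by ring⟩ : D₂ ∣ D) hwD
  have hw3 : w.valuation L (D₃ : L) = 1 :=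
    valuation_natCast_eq_one_of_dvd w (⟨2 * D₁ * D₂ * D₄, by ring⟩ : D₃ ∣ D) hwD
  have hw4 : w.valuation L (D₄ : L) = 1 :=
    valuation_natCast_eq_one_of_dvd w (⟨2 * D₁ * D₂ * D₃, by ring⟩ : D₄ ∣ D) hwD
  refine ⟨hw2, hD₄ L w hw4 c (Finset.mem_singleton_self c), hD₁ L w hw1,
    fun b hb b' hb' hne => ?_, fun b hb g hg ρ hρ hg0 hlt => ?_⟩
  · have hmem : b - b' ∈ ((B ×ˢ B).image fun q => q.1 - q.2).filter fun x => x ≠ 0 :=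
      Finset.mem_filter.mpr ⟨Finset.mem_image.mpr ⟨(b, b'), Finset.mem_product.mpr ⟨hb, hb'⟩, rfl⟩,
        sub_ne_zero.mpr hne⟩
    have h := hD₂ L w hw2' (b - b') hmem
    rwa [map_sub] at h
  · have hmap : (G b).map (algebraMap K L) = g := DeC.map_fiber k c b (g := G b) rfl hg
    have he : g.eval ρ = aeval ρ (G b) := by rw [← hmap, eval_map_algebraMap]
    have he' : (derivative g).eval ρ = aeval ρ (derivative (G b)) := by
      rw [← hmap, derivative_map, eval_map_algebraMap]
    rw [he] at hg0 hlt ⊢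
    rw [he']
    exact hD₃ b hb L w ρ hw3 hρ hg0 hlt

open scoped Classical in
/-- **JUNCTION for the family `t_c`, enlargeable bad set.** For `k`, `c ≠ 0` and `B ⊂ K` let
`S = S_bad(e, c, B)` be as in `DeC.exists_badPrimes`. Then for every number field `L ⊇ K`, every finite
`T ⊇ S` (the consumer may enlarge the bad set, e.g. by the exceptional primes of the W5c converse),
every point datum `(r, s, t, N)` in `L` in the normal forms of the `t_c` route (`s² = 1 − 4r^e`,
`t·rs = s + c·r^{k+2}`, `N = −s³ + c((k+1)r^{k+2} − 2r^{3k+3})`, `N ≠ 0`, `t ∉ B`), with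
`Sbad := ⋃_{p∈T} placesOver L p`, given the converse `hconv` off `Sbad` and a finite set `W` of places
which off `Sbad` meet `B` (`∃ b ∈ B, 0 < ord_w (t − b)`), the placewise inequalities hold VERBATIM as
the hypotheses `hmeet`/`hoff` of `FibreConductor.inv_finrank_mul_sum_logNorm_le_slope` (with
`B ↦ B.map (K → L)`). [cite: MochizukiGenEll2010, Prop 1.6 p.10] -/
theorem DeC.hmeet_hoff_off_badPrimes_of_subset (k : ℕ) {c : K} (hc : c ≠ 0) (B : Finset K) :
    ∃ S : Finset ℕ, 2 ∈ S ∧ (∀ p ∈ S, p.Prime) ∧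
      ∀ (L : Type u) [Field L] [NumberField L] [Algebra K L] (T : Finset ℕ), S ⊆ T →
        ∀ {r s t N : L},
        s ^ 2 = 1 - 4 * r ^ (2 * k + 1) → t * (r * s) = s + algebraMap K L c * r ^ (k + 2) →
        N = -s ^ 3 + algebraMap K L c * ((k + 1) * r ^ (k + 2) - 2 * r ^ (3 * k + 3)) → N ≠ 0 →
        (∀ b ∈ B, t ≠ algebraMap K L b) →
        ∀ W : Finset (HeightOneSpectrum (𝓞 L)),
        (∀ w : HeightOneSpectrum (𝓞 L), w ∉ T.attach.biUnion (fun p => placesOver L p.1) →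
          w.valuation L N < 1 →
            ∃ b ∈ B.map ⟨algebraMap K L, (algebraMap K L).injective⟩, w.valuation L (t - b) < 1) →
        (∀ w ∈ W, w ∉ T.attach.biUnion (fun p => placesOver L p.1) →
          ∃ b ∈ B.map ⟨algebraMap K L, (algebraMap K L).injective⟩, 0 < ord L w (t - b)) →
        (∀ w ∈ W, w ∉ T.attach.biUnion (fun p => placesOver L p.1) →
            1 + (ord L w N).toNat ≤
              ∑ b ∈ B.map ⟨algebraMap K L, (algebraMap K L).injective⟩, (ord L w (t - b)).toNat) ∧
        (∀ w, w ∉ W → w ∉ T.attach.biUnion (fun p => placesOver L p.1) →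
            (ord L w N).toNat ≤
              ∑ b ∈ B.map ⟨algebraMap K L, (algebraMap K L).injective⟩, (ord L w (t - b)).toNat) := by
  classical
  obtain ⟨S, h2S, hSp, hS⟩ := DeC.exists_badPrimes (K := K) k hc B
  refine ⟨S, h2S, hSp, ?_⟩
  intro L _ _ _ T hST r s t N hcurve ht hN hN0 htB W hconv hW
  set ι : K ↪ L := ⟨algebraMap K L, (algebraMap K L).injective⟩ with hι
  set Sbad := T.attach.biUnion (fun p => placesOver L p.1) with hSbad
  have hmono : ∀ w : HeightOneSpectrum (𝓞 L), w ∉ Sbad →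
      w ∉ S.attach.biUnion (fun p => placesOver L p.1) := by
    intro w hw hwS
    obtain ⟨p, -, hp⟩ := Finset.mem_biUnion.mp hwS
    exact hw (Finset.mem_biUnion.mpr ⟨⟨p.1, hST p.2⟩, Finset.mem_attach _ _, hp⟩)
  have htB' : ∀ b ∈ B.map ι, t ≠ b := by
    intro b hb
    obtain ⟨b₀, hb₀, rfl⟩ := Finset.mem_map.mp hb
    exact htB b₀ hb₀
  refine DeC.hmeet_hoff_of_gap k hcurve ht hN hN0 (B.map ι) htB'
    (fun d => C ((algebraMap K L c) ^ 2) * X ^ (2 * k + 4) + C (4 * d ^ 2) * X ^ (2 * k + 3)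
      - C (8 * d) * X ^ (2 * k + 2) + C 4 * X ^ (2 * k + 1) - C (d ^ 2) * X ^ 2 + C (2 * d) * X - 1)
    (fun _ _ => rfl) Sbad W ?_ ?_ ?_ ?_ ?_ hconv hW
  · intro w hw
    exact (hS L w (hmono w hw)).1
  · intro w hw
    exact (hS L w (hmono w hw)).2.1
  · intro w hw b hb
    obtain ⟨b₀, hb₀, rfl⟩ := Finset.mem_map.mp hb
    exact (hS L w (hmono w hw)).2.2.1 b₀ hb₀
  · intro w hw b hb b' hb' hne
    obtain ⟨b₀, hb₀, rfl⟩ := Finset.mem_map.mp hb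
    obtain ⟨b₀', hb₀', rfl⟩ := Finset.mem_map.mp hb'
    have hne₀ : b₀ ≠ b₀' := fun h => hne (by rw [h])
    exact (hS L w (hmono w hw)).2.2.2.1 b₀ hb₀ b₀' hb₀' hne₀
  · intro w hw b hb ρ hρ hg0 hlt
    obtain ⟨b₀, hb₀, rfl⟩ := Finset.mem_map.mp hb
    exact (hS L w (hmono w hw)).2.2.2.2 b₀ hb₀ _ rfl ρ hρ hg0 hlt

end BadPrimes

end Literature.NumberTheory.DiophantineGeometry.GenEll
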